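import Summits.QuantumAdvantage.QuantumAdvantage.Theorems.LinnikCubicClassGroupsPureCubicClassGroupFBQPStubSemCoreB
import Summits.QuantumAdvantage.QuantumAdvantage.Theorems.LinnikCubicClassGroupsPureCubicClassGroupFBQPStubSemCircleB
import Summits.QuantumAdvantage.QuantumAdvantage.Theorems.LinnikCubicClassGroupsPureCubicClassGroupFBQPStubClassTableSemClasses
import Summits.QuantumAdvantage.QuantumAdvantage.Theorems.LinnikCubicClassGroupsPureCubicClassGroupFBQPStubClassTableSemCells
import Summits.QuantumAdvantage.QuantumAdvantage.Theorems.LinnikCubicClassGroupsPureCubicClassGroupFBQPStubClassTableSemCoins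
import Summits.QuantumAdvantage.QuantumAdvantage.Theorems.LinnikCubicClassGroupsPureCubicClassGroupFBQPStubClassTableSemIndex
import Summits.QuantumAdvantage.QuantumAdvantage.Theorems.LinnikCubicClassGroupsPureCubicClassGroupFBQPStubClassTableSemSlots
import Summits.QuantumAdvantage.QuantumAdvantage.Theorems.LinnikCubicClassGroupsPureCubicClassGroupFBQPStubCubicGiantStepCycleRedSem
import Summits.QuantumAdvantage.QuantumAdvantage.Theorems.LinnikCubicClassGroupsPureCubicClassGroupFBQPStubVoronoiChain
import Summits.QuantumAdvantage.QuantumAdvantage.Theorems.LinnikCubicClassGroupsPureCubicClassGroupFBQPStubPacking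
import Literature.NumberTheory.CubicFields.PeriodicChainCellsDefects
import Literature.Computability.Cryptography.CubicClassSamplingSpecs
import Summits.QuantumAdvantage.QuantumAdvantage.Theorems.LinnikCubicClassGroupsPureCubicClassGroupFBQPOfParts
import Summits.QuantumAdvantage.QuantumAdvantage.Theorems.LinnikCubicClassGroupsPureCubicClassGroupFBQPStubClassSamplingLaw
import Summits.QuantumAdvantage.QuantumAdvantage.Theorems.LinnikCubicClassGroupsPureCubicClassGroupFBQPStubSemAffine

/-!
# Crux `LinnikCubicClassGroups.PureCubicClassGroupFBQP` (stmt-QuantumAdvantage-11544) — PROVED (the table semantics `stub_semMain` and the crux)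

Line `arakelov-giant-step-cycle`, registered stub `stub_semMain` (S5b-P5b-M) of skeleton v18: the composition of the table
semantics `ClaimTableSem` (`Literature/Computability/Cryptography/CubicClassSamplingSpecs.lean`) — the ladder class table
`classTableOpQ` of the pure cubic field has the structural interface `ClassTableInterfaceQ3` — from the three real-variable
stubs (`stub_semCoords`, `stub_semDrift` — imported by the core —, `stub_semAffine`, taken as a hypothesis) and the landed packages:

* witnesses: `F₀` = the table of the bundle with the TRUE cube roots at the reduced position (`coins_clause`); slot ideals `𝔤_t`
  (`slots_package`) and their cylinder minima `γ_t` (`RedSem` via `redSem_of_specs`); `Λ, cls, A_g, α_E, λ` (`classes_package`);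
  per class the circle `G_g, n₀, idx, Lab` (`circle_packageB`) and the cell function `C g i` at `i R/2^s`;
  `Y_E = −log σ₁ α_E + ((R̂−R)/R̂) Σ_t e_t log σ₁ γ_t`, `y_E = 2^s fract(Y_E/R)`, `σ_E = ⌊y_E⌋`, `μ_t = (λ_t − ((R̂−R)/R̂) log σ₁ γ_t)/R`;
  `Badκ` = wrong-root coin values; `D` = positions whose grid window meets a breakpoint of their class circle;
* clauses: index (`closure_slots_eq`), coins (`coins_clause`), defect density (`ap_defect_card_le`, `num_defect_card`,
  `defects_biUnion`), the shift-cell identity (`table_value_eq_shiftCell`), classes = cosets and distinct cells of distinct classes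
  (`classes_package`), exact-affine shifts (`stub_semAffine`), run-shaped fibres and the cell count (`cells_package`).
Finally the crux BY NAME: `PureCubicClassGroupFBQP_of_parts : ClaimTableSem → ClaimSamplingLaw → PureCubicClassGroupFBQP`
(`…OfParts.lean`, the composition of the whole line) applied to `stub_semMain stub_semCoords stub_semDrift stub_semAffine` and
`stub_classSamplingLaw`. Statement: assuming `DegreeOnePrimesEscape`, `x ↦` the `2|x|+8` low bits of the class number of
`ℚ(∛ decodeNat x)` (non-cube) is in `FBQP` — random large degree-one primes as the factor base (no GRH), the Buchmann–Williams
infrastructure of the complex cubic field (unit rank one) for the regulator, and ONE Fourier-sampling experiment over `ℤ_M^T × ℤ_{2^s}`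
on the ladder class table for the subgroup order. [Hallgren 2005 §4–5; Buchmann–Williams 1988 §3]
-/

set_option linter.dupNamespace false

namespace Summit.QuantumAdvantage.QuantumAdvantage.Theorems.LinnikCubicClassGroups

open scoped NumberField nonZeroDivisors
open NumberField
open Literature.NumberTheory.CubicFields
open Literature.NumberTheory.CubicFields.PureCubicCodes (Canon Mem)
open Literature.NumberTheory.NumberFields.PureCubic (abs_discr_le ne_zero_of_squarefree_mul)
open Literature.Computability.Cryptography
open Literature.Computability.Cryptography.CubicClassTable
open Literature.Computability.Cryptography.CubicClassTable.WalkFns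
open Literature.Computability.Cryptography.CubicClassSampling (ClaimTableSem ShiftCellCosetTable ClassTableInterfaceQ3)

set_option maxHeartbeats 800000 in
/-- **S5b-P5b-M `stub_semMain`** (registered stub of line `arakelov-giant-step-cycle`, skeleton v18): the table semantics
`ClaimTableSem` from the coordinate lemma, the drift lemma, the affine-shift lemma and the landed packages (module docstring;
the composition is long, hence the heartbeat budget). -/
theorem stub_semMain :
    (∀ (G : ℤ → ℝ), StrictMono G → ∀ (n₀ : ℕ), 0 < n₀ → ∀ (R : ℝ), (∀ i, G (i + n₀) = G i + R) →
      ∀ (idx : ℝ → ℤ), (∀ x, G (idx x) ≤ x ∧ x < G (idx x + 1)) →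
      ∀ (Lab : ℤ → ℕ × List ℤ), (∀ i j, Lab i = Lab j ↔ (n₀ : ℤ) ∣ i - j) →
      ∀ (npp s : ℕ) (η ηd : ℝ), 0 ≤ η → 0 ≤ ηd →
      ∀ (σ j : ℕ) (u : ℝ),
        (σ : ℝ) * (R / ((2 ^ s : ℕ) : ℝ)) + (j : ℝ) * (R / ((2 ^ s : ℕ) : ℝ)) - ηd < u →
        u < (σ : ℝ) * (R / ((2 ^ s : ℕ) : ℝ)) + (j : ℝ) * (R / ((2 ^ s : ℕ) : ℝ)) + R / ((2 ^ s : ℕ) : ℝ) + ηd →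
        (∀ (k : ℤ) (m : ℕ), (m : ℝ) / (2 : ℝ) ^ npp < G (k + 1) - G k →
          ¬ ((σ : ℝ) * (R / ((2 ^ s : ℕ) : ℝ)) + (j : ℝ) * (R / ((2 ^ s : ℕ) : ℝ)) - (η + ηd) ≤ G k + m / (2 : ℝ) ^ npp ∧
              G k + m / (2 : ℝ) ^ npp ≤
                (σ : ℝ) * (R / ((2 ^ s : ℕ) : ℝ)) + (j : ℝ) * (R / ((2 ^ s : ℕ) : ℝ)) + R / ((2 ^ s : ℕ) : ℝ) + (η + ηd))) →
        (∀ (k : ℤ) (m : ℕ), (m : ℝ) / (2 : ℝ) ^ npp < G (k + 1) - G k → η < |u - (G k + m / (2 : ℝ) ^ npp)|) ∧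
        (Lab (idx u), ⌊(u - G (idx u)) * (2 : ℝ) ^ npp⌋₊) =
          (Lab (idx ((((σ + j) % 2 ^ s : ℕ) : ℝ) * (R / ((2 ^ s : ℕ) : ℝ)))),
            ⌊(((((σ + j) % 2 ^ s : ℕ) : ℝ) * (R / ((2 ^ s : ℕ) : ℝ))) -
              G (idx ((((σ + j) % 2 ^ s : ℕ) : ℝ) * (R / ((2 ^ s : ℕ) : ℝ))))) * (2 : ℝ) ^ npp⌋₊)) →
    (∀ (prec k s r : ℕ) (R main BN : ℝ) (j' : ℕ) (N tstar : ℤ), 0 < r → k + s ≤ prec → j' < 2 ^ s →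
        |(r : ℝ) - 2 ^ k * R| ≤ 1 →
        tstar = ((j' * r * 2 ^ (prec - k - s) : ℕ) : ℤ) + N * ((r * 2 ^ (prec - k) : ℕ) : ℤ) →
        |(N : ℝ) - 2 ^ prec * main / ((r * 2 ^ (prec - k) : ℕ) : ℝ)| ≤ BN →
        |(tstar : ℝ) / 2 ^ prec -
            ((j' : ℝ) * (R / ((2 ^ s : ℕ) : ℝ)) + (N : ℝ) * R + ((r : ℝ) / 2 ^ k - R) / ((r : ℝ) / 2 ^ k) * main)| ≤
          (BN + 1) / 2 ^ k) →
    (∀ (R : ℝ), 0 < R → ∀ (s T : ℕ) (Y : ℕ → ℝ) (μ : Fin T → ℝ) (d : ℕ → Fin T → ℝ) (cls : ℕ → ℕ),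
        (∀ E E', cls E = cls E' → ∃ z : ℤ, Y E' - Y E + R * ∑ t, μ t * (d E' t - d E t) = z * R) →
        (∀ E, 0 ≤ (2 : ℝ) ^ s * Int.fract (Y E / R) ∧ (2 : ℝ) ^ s * Int.fract (Y E / R) < (2 : ℝ) ^ s) ∧
        (∀ E, (⌊(2 : ℝ) ^ s * Int.fract (Y E / R)⌋₊ : ℝ) ≤ (2 : ℝ) ^ s * Int.fract (Y E / R) ∧
          (2 : ℝ) ^ s * Int.fract (Y E / R) < (⌊(2 : ℝ) ^ s * Int.fract (Y E / R)⌋₊ : ℝ) + 1) ∧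
        (∀ E, ⌊(2 : ℝ) ^ s * Int.fract (Y E / R)⌋₊ < 2 ^ s) ∧
        (∀ E, ∃ q : ℤ, (2 : ℝ) ^ s * Int.fract (Y E / R) * (R / ((2 ^ s : ℕ) : ℝ)) = Y E + q * R) ∧
        (∀ E E', cls E = cls E' → ∃ z : ℤ, (2 : ℝ) ^ s * Int.fract (Y E' / R) - (2 : ℝ) ^ s * Int.fract (Y E / R) +
          (2 : ℝ) ^ s * ∑ t, μ t * (d E' t - d E t) = (2 : ℝ) ^ s * z)) →
    ClaimTableSem := by
  intro _hCoords _hDrift hAffine Fw lexE logE invE latScale a b hab hab1 K _ _ hdeg θ hθ σ₁ σ₂ hσ₂ ord hord hordm hlex hlog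
    hinv hscale hredL hprod hprime hroots m ps r k hps hm hr ℓe npp ℓy ℓκ ℓb prec s s₀ Tdbl Bfin Bb margin cap e _h20 hk hkprec
    hs hsy hs₀ hTdbl hmargin hBb hcap hcapp hℓb hℓκ
  classical
  -- ### the instance, the coin-free bundle, basic numerics
  obtain ⟨ha, hb⟩ := ne_zero_of_squarefree_mul hab
  set I : Inst := ⟨a, b, m, ps, ord, r, k, prec, s, ℓe, npp, ℓy, ℓκ, ℓb, s₀, Tdbl, Bfin, Bb, margin⟩ with hI
  set rts : ℕ × ℕ × List Bool → List ℕ := fun x => (List.range x.1).filter (fun r => r ^ 3 % x.1 = x.2.1 % x.1) with hrts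
  set F' : WalkFns := { Fw with roots := rts } with hF'
  have hsz : I.ps.length < 2 ^ Nat.size ps.length := Nat.lt_size_self _
  obtain ⟨hprec, h9, hk4, hks, hnpp⟩ := inst_numerics (ℓe := ℓe) (s := s) (npp := npp) (e := e) (k := k) (prec := prec)
    (sz := Nat.size ps.length) ha hb hk hkprec
  have hLD' : Nat.size (a * b) ≤ Nat.size (27 * a ^ 2 * b ^ 2) := size_ab_le ha hb
  have hred' : RedSem F' a b K θ σ₁ σ₂ :=
    redSem_of_specs a b hab K θ hθ σ₁ σ₂ lexE logE invE latScale Fw.latProd Fw.redL Fw.rhoS Fw.starS Fw.unitS rts Fw.primeL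
      hlex hlog hinv hscale hredL
  have hprod' : ProdSpec I.a I.b K θ F'.latProd := hprod
  have hcap' : (243 * I.a ^ 2 * I.b ^ 2) ^ 2 ≤ cap := hcap
  have hps' : ∀ p ∈ I.ps, p.Prime ∧ ¬ p ∣ 3 * I.m := hps
  have hd1 : (1 : ℝ) ≤ |(discr K : ℝ)| := by
    rw [← Int.cast_abs]; exact_mod_cast Int.one_le_abs (discr_ne_zero K)
  have hd2 : (2 : ℝ) ≤ |(discr K : ℝ)| := by
    have h := abs_discr_gt_two (K := K) (by rw [hdeg]; norm_num)
    rw [← Int.cast_abs]; exact_mod_cast h.le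
  have hd27 : |(discr K : ℝ)| ≤ 27 * (a : ℝ) ^ 2 * (b : ℝ) ^ 2 := by
    have h := abs_discr_le hdeg hab hab1 hθ
    rw [← Int.cast_abs]; exact_mod_cast h
  obtain ⟨hLBKN, -, hdLD, hd0⟩ := walk_consts (I := I) hdeg hab hab1 hθ hprec
  obtain ⟨hLB0, -⟩ := logB_bounds (K := K)
  have hLBd6 : Real.log (3 * Real.sqrt |(discr K : ℝ)|) ≤ |(discr K : ℝ)| ^ 6 := logB_le_pow_six hd2
  have hRd6 : Units.regulator K ≤ |(discr K : ℝ)| ^ 6 := regulator_le_abs_discr_pow_six K hdeg σ₁ σ₂ hσ₂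
  -- ### the slots and their cylinder minima
  obtain ⟨𝔤, hslot', hkind, hall, hgT⟩ := slots_package (K := K) (θ := θ) (F := F') (I := I) rfl rfl hm hps' hord hordm
    hprime (fun x => rfl)
  have h𝔤 : ∀ t, t < 3 * ps.length → 𝔤 t ≠ ⊥ := fun t ht => (hslot' 0 t ht).1
  have hγex : ∀ t, ∃ γ : K, t < I.T → γ ∈ (𝔤 t : FractionalIdeal (𝓞 K)⁰ K) ∧ 0 < σ₁ γ ∧ ‖σ₂ γ‖ < 1 ∧
      (∀ φ : K, φ ∈ (𝔤 t : FractionalIdeal (𝓞 K)⁰ K) → 0 < σ₁ φ → ‖σ₂ φ‖ < 1 → σ₁ γ ≤ σ₁ φ) := by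
    intro t
    by_cases ht : t < I.T
    · obtain ⟨h0, hc, hmem⟩ := hslot' 0 t ht
      obtain ⟨γ, hγJ, hγpos, hγcyl, hγmin, -⟩ := hred' prec (F'.gT I 0 t) (𝔤 t : FractionalIdeal (𝓞 K)⁰ K)
        (FractionalIdeal.coeIdeal_ne_zero.mpr h0) hc hmem
      exact ⟨γ, fun _ => ⟨hγJ, hγpos, hγcyl, hγmin⟩⟩
    · exact ⟨1, fun h => absurd h ht⟩
  choose γ hγ using hγex
  have hslot : ∀ v, ∀ t < I.T, 𝔤 t ≠ ⊥ ∧ Canon (F'.gT I v t) ∧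
      (∀ φ : K, Mem θ I.b (F'.gT I v t) φ ↔ φ ∈ (𝔤 t : FractionalIdeal (𝓞 K)⁰ K)) ∧
      γ t ∈ (𝔤 t : FractionalIdeal (𝓞 K)⁰ K) ∧ 0 < σ₁ (γ t) ∧ ‖σ₂ (γ t)‖ < 1 ∧
      (∀ φ : K, φ ∈ (𝔤 t : FractionalIdeal (𝓞 K)⁰ K) → 0 < σ₁ φ → ‖σ₂ φ‖ < 1 → σ₁ (γ t) ≤ σ₁ φ) := by
    intro v t ht
    obtain ⟨h0, hc, hmem⟩ := hslot' v t ht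
    exact ⟨h0, hc, hmem, hγ t ht⟩
  -- ### the regulator unit, the six-gap, `R ≥ log 2 / 6`
  obtain ⟨-, n₁, -, -, ε, hn₁, -, hn₁R, hε, hreg, -⟩ :=
    circle_packageB (σ₁ := σ₁) hdeg hσ₂ hab hab1 hθ (1 : FractionalIdeal (𝓞 K)⁰ K) one_ne_zero
  have h6 : ∀ A : FractionalIdeal (𝓞 K)⁰ K, A ≠ 0 → ∀ x₀ ∈ posRelMinima σ₁ σ₂ A, ∀ i : ℤ,
      2 * σ₁ (voronoiChain σ₁ σ₂ A x₀ i) ≤ σ₁ (voronoiChain σ₁ σ₂ A x₀ (i + 6)) :=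
    fun A _ x₀ hx₀ i => voronoiChain_six_gap hdeg hσ₂ ε hε stub_packing hx₀ i
  have hR6 : Real.log 2 / 6 ≤ Units.regulator K := regulator_ge_of_period hn₁ hn₁R
  have hR16 : (1 : ℝ) / 16 ≤ Units.regulator K := regulator_sixteenth_le hR6
  have hRpos : 0 < Units.regulator K := lt_of_lt_of_le (by norm_num) hR16
  set R : ℝ := Units.regulator K with hRdef
  -- ### the classes
  obtain ⟨Λ, hfin, cls, Ag, α, lam, hΛidx, hcls, hAg0, hAα, hlam, hinj⟩ :=
    classes_package hdeg hσ₂ hε hreg (3 * ps.length) (2 ^ ℓe) 𝔤 h𝔤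
  -- ### the class circles
  have hcirc := fun g => circle_packageB (σ₁ := σ₁) hdeg hσ₂ hab hab1 hθ (Ag g) (hAg0 g)
  choose x₀ n₀ idx Lab εg hn₀ hx₀ hn₀R _hεg _hregg _hperK hmono hper hgap hposc hidx hLab hLabper _hone _h6g using hcirc
  -- ### the cell functions, the shifts, the slopes
  set S2 : ℝ := ((2 ^ s : ℕ) : ℝ) with hS2
  have hS2pos : 0 < S2 := by rw [hS2]; positivity
  have hS2e : S2 = (2 : ℝ) ^ s := by rw [hS2]; push_cast; ring
  set C : ℕ → ℕ → (ℕ × List ℤ) × ℕ := fun g i =>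
    (Lab g (idx g ((i : ℝ) * (R / S2))),
      ⌊(((i : ℝ) * (R / S2)) - Real.log (σ₁ (voronoiChain σ₁ σ₂ (Ag g) (x₀ g) (idx g ((i : ℝ) * (R / S2)))))) *
        (2 : ℝ) ^ npp⌋₊) with hC
  set cδ : ℝ := ((r : ℝ) / 2 ^ k - R) / ((r : ℝ) / 2 ^ k) with hcδ
  set dg : ℕ → Fin (3 * ps.length) → ℝ := fun E t => ((E / (2 ^ ℓe) ^ (t : ℕ) % 2 ^ ℓe : ℕ) : ℝ) with hdg
  set Y : ℕ → ℝ := fun E => -Real.log (σ₁ (α E)) + cδ * ∑ t : Fin (3 * ps.length), dg E t * Real.log (σ₁ (γ t)) with hY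
  set μ : Fin (3 * ps.length) → ℝ := fun t => (lam t - cδ * Real.log (σ₁ (γ t))) / R with hμ
  set y : ℕ → ℝ := fun E => (2 : ℝ) ^ s * Int.fract (Y E / R) with hy
  set σf : ℕ → ℕ := fun E => ⌊y E⌋₊ with hσf
  -- the affine package
  have hYaff : ∀ E E', cls E = cls E' → ∃ z : ℤ, Y E' - Y E + R * ∑ t, μ t * (dg E' t - dg E t) = z * R := by
    intro E E' hEE'
    obtain ⟨z, hz⟩ := hlam E E' hEE'
    refine ⟨-z, ?_⟩
    have hsum : R * ∑ t, μ t * (dg E' t - dg E t) =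
        ∑ t, lam t * (dg E' t - dg E t) - cδ * ∑ t, (dg E' t - dg E t) * Real.log (σ₁ (γ t)) := by
      rw [Finset.mul_sum, Finset.mul_sum, ← Finset.sum_sub_distrib]
      refine Finset.sum_congr rfl fun t _ => ?_
      rw [hμ]; field_simp
    have hYd : Y E' - Y E = -(Real.log (σ₁ (α E')) - Real.log (σ₁ (α E))) +
        cδ * ∑ t, (dg E' t - dg E t) * Real.log (σ₁ (γ t)) := by
      rw [hY]; simp only
      rw [show ∑ t, (dg E' t - dg E t) * Real.log (σ₁ (γ t)) =
          ∑ t, dg E' t * Real.log (σ₁ (γ t)) - ∑ t, dg E t * Real.log (σ₁ (γ t)) by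
        rw [← Finset.sum_sub_distrib]; exact Finset.sum_congr rfl fun t _ => by ring]
      ring
    have hz' : Real.log (σ₁ (α E')) - Real.log (σ₁ (α E)) - ∑ t, lam t * (dg E' t - dg E t) = z * R := by
      rw [hdg]; exact hz
    rw [hsum, hYd]; push_cast; linarith
  obtain ⟨hy01, hyfloor, hσlt, hycong, hyaff⟩ := hAffine R hRpos s (3 * ps.length) Y μ dg cls hYaff
  -- ### the coin clause
  set W : ℕ := (2 ^ ℓe) ^ (3 * ps.length) with hW
  have hWI : I.W = W := rfl
  have hW0 : 0 < W := by rw [hW]; positivity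
  have hpcap : ∀ p ∈ I.ps, p ≤ cap := fun p hp => prime_le_cap ha hb (hcapp p hp)
  obtain ⟨Badκ, hBadcard, hBadoff⟩ : ∃ Badκ : Finset ℕ, ((Badκ.card : ℝ) ≤ (1 / 2) ^ (40 + e) * 2 ^ ℓκ) ∧
      ∀ v : ℕ, (v / (W * 2 ^ ℓy)) % 2 ^ ℓκ ∉ Badκ →
        Fw.classTableOpQ I cap v = F'.classTableOpQ I cap (v % (W * 2 ^ ℓy)) :=
    ⟨_, coins_clause Fw I cap e hroots hps' hpcap hℓb hℓκ⟩
  -- ### the defect sets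
  set η₀ : ℝ := R / 2 ^ (s + 3) + R / 2 ^ (s + 3) with hη₀
  set B : ℕ → Finset ℕ := fun E => (Finset.range (2 ^ ℓy)).filter (fun j : ℕ => ∃ (k : ℤ) (m : ℕ),
      (m : ℝ) / (2 : ℝ) ^ npp < Real.log (σ₁ (voronoiChain σ₁ σ₂ (Ag (cls E)) (x₀ (cls E)) (k + 1))) -
        Real.log (σ₁ (voronoiChain σ₁ σ₂ (Ag (cls E)) (x₀ (cls E)) k)) ∧
      (σf E : ℝ) * (R / S2) + (j : ℝ) * (R / S2) - η₀ ≤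
        Real.log (σ₁ (voronoiChain σ₁ σ₂ (Ag (cls E)) (x₀ (cls E)) k)) + m / (2 : ℝ) ^ npp ∧
      Real.log (σ₁ (voronoiChain σ₁ σ₂ (Ag (cls E)) (x₀ (cls E)) k)) + m / (2 : ℝ) ^ npp ≤
        (σf E : ℝ) * (R / S2) + (j : ℝ) * (R / S2) + R / S2 + η₀) with hB
  set D : Finset ℕ := (Finset.range W).biUnion (fun E => (B E).image (fun j => E + W * j)) with hD
  -- per-block defect count
  have hBcard : ∀ E, E < W → ((B E).card : ℝ) ≤ (1 / 2) ^ (30 + e) * 2 ^ ℓy := by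
    intro E _
    set g := cls E with hg
    have hGm : StrictMono (fun i => Real.log (σ₁ (voronoiChain σ₁ σ₂ (Ag g) (x₀ g) i))) := hmono g
    have hΔ : 0 < R / S2 := div_pos hRpos hS2pos
    have h2η : 2 * η₀ < R / S2 := by
      rw [hη₀, hS2e, pow_add]
      have h8 : (0 : ℝ) < 2 ^ s := by positivity
      rw [show R / (2 ^ s * 2 ^ 3) = (R / 2 ^ s) / 8 by ring]
      have : 0 < R / 2 ^ s := div_pos hRpos h8
      linarith
    have hq : (2 ^ ℓy : ℕ) * (R / S2) + R / S2 + 2 * η₀ ≤ ((2 ^ (ℓy - s) + 1 : ℕ) : ℝ) * R := by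
      have e1 : ((2 ^ ℓy : ℕ) : ℝ) * (R / S2) = ((2 ^ (ℓy - s) : ℕ) : ℝ) * R := by
        rw [hS2e]; push_cast
        rw [show (2 : ℝ) ^ ℓy = 2 ^ (ℓy - s) * 2 ^ s by rw [← pow_add]; congr 1; omega]
        field_simp
      rw [e1]; push_cast
      have h1 : R / S2 + 2 * η₀ ≤ R := by
        rw [hη₀, hS2e]
        have hs1 : (2 : ℝ) ≤ 2 ^ s ∨ s = 0 := by
          rcases Nat.eq_zero_or_pos s with h | h
          · exact Or.inr h
          · exact Or.inl (by calc (2:ℝ) = 2 ^ 1 := by norm_num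
                                 _ ≤ 2 ^ s := pow_le_pow_right₀ (by norm_num) h)
        have h8 : R / 2 ^ (s + 3) = R / 2 ^ s / 8 := by rw [pow_add]; ring
        rw [h8]
        have hRs : R / 2 ^ s ≤ R := div_le_self hRpos.le (one_le_pow₀ (by norm_num))
        rcases hs1 with h2 | h0
        · have : R / 2 ^ s ≤ R / 2 := div_le_div_of_nonneg_left hRpos.le (by norm_num) h2
          linarith
        · subst h0; simp at hRs ⊢; linarith
      linarith
    have hNpos : (0 : ℝ) < (2 : ℝ) ^ npp := by positivity
    have h := ap_defect_card_le hGm (hn₀ g) (hper g) (hidx g) hNpos ((σf E : ℝ) * (R / S2)) hΔ h2η (2 ^ ℓy)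
      (2 ^ (ℓy - s) + 1) hq (hgap g)
    have h2 := num_defect_card (npp := npp) (e := e) hRpos.le hRd6 hLBd6 (period_le_nine_pow_six (hn₀R g) hRd6 hd1) hd1 hdLD
      (by change npp + 6 * Nat.size (27 * a ^ 2 * b ^ 2) + 36 + e ≤ s; omega) hsy
    push_cast at h h2 ⊢
    exact h.trans h2
  obtain ⟨hDcard, hDoff⟩ := defects_biUnion hW0 B hBcard
  -- ### the witnesses
  refine ⟨Λ, hfin, fun u => F'.classTableOpQ I cap u, cls, σf, C, y, μ, Badκ, D, ?_, ?_⟩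
  · -- the index of the hidden lattice
    rw [hΛidx, closure_slots_eq 𝔤 h𝔤 ps hkind hall]
  refine ⟨hBadcard, fun v hv => hBadoff v hv, ?_, ?_, ?_, ?_, ?_, ?_, ?_⟩
  · -- (iii) the defect density
    calc ((D.card : ℕ) : ℝ) ≤ W * ((1 / 2) ^ (30 + e) * 2 ^ ℓy) := hDcard
      _ = (1 / 2) ^ (30 + e) * ((W * 2 ^ ℓy : ℕ) : ℝ) := by push_cast; ring
  · -- (iii) the shift-cell identity off the defects
    intro E hE j hj hEj
    have hjB : j ∉ B E := hDoff E hE j hEj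
    have hgood : ∀ (k' : ℤ) (m' : ℕ), (m' : ℝ) / (2 : ℝ) ^ npp <
        Real.log (σ₁ (voronoiChain σ₁ σ₂ (Ag (cls E)) (x₀ (cls E)) (k' + 1))) -
          Real.log (σ₁ (voronoiChain σ₁ σ₂ (Ag (cls E)) (x₀ (cls E)) k')) →
        ¬ ((σf E : ℝ) * (R / S2) + (j : ℝ) * (R / S2) - η₀ ≤
            Real.log (σ₁ (voronoiChain σ₁ σ₂ (Ag (cls E)) (x₀ (cls E)) k')) + m' / (2 : ℝ) ^ npp ∧
          Real.log (σ₁ (voronoiChain σ₁ σ₂ (Ag (cls E)) (x₀ (cls E)) k')) + m' / (2 : ℝ) ^ npp ≤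
            (σf E : ℝ) * (R / S2) + (j : ℝ) * (R / S2) + R / S2 + η₀) := by
      intro k' m' hm' hcon
      exact hjB (Finset.mem_filter.mpr ⟨Finset.mem_range.mpr hj, k', m', hm', hcon⟩)
    have hyE : ∃ q : ℤ, y E * (R / S2) = (-Real.log (σ₁ (α E)) + cδ *
        ∑ t ∈ Finset.range I.T, ((E / (2 ^ I.ℓe) ^ t % 2 ^ I.ℓe : ℕ) : ℝ) * Real.log (σ₁ (γ t))) + q * R := by
      obtain ⟨q, hq⟩ := hycong E
      refine ⟨q, ?_⟩
      rw [← hS2] at hq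
      rw [hq, hY]
      simp only [hdg]
      rw [← Fin.sum_univ_eq_sum_range (fun t => ((E / (2 ^ I.ℓe) ^ t % 2 ^ I.ℓe : ℕ) : ℝ) * Real.log (σ₁ (γ t)))]
      rfl
    have hmain := table_value_eq_shiftCell (F := F') (I := I) hdeg hσ₂ ε hε hreg hab hab1 hθ hred' hprod' hcap' hord hordm h6
      hR6 hs₀ hTdbl hBb hmargin hr hsz hk hkprec hs hslot (hWI ▸ hE) hj (hAα E).1 (hAα E).2
      (hx₀ (cls E)) (hn₀ (cls E)) (hper (cls E)) (hidx (cls E)) (hLab (cls E)) (hLabper (cls E)) (hyfloor E) hyE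
      (by rw [← hS2, ← hη₀]; exact hgood)
    rw [← hS2] at hmain
    change F'.classTableOpQ I cap (E + I.W * j) = C (cls E) ((σf E + j) % 2 ^ s)
    rw [hmain]
  · -- (iv) classes are cosets
    intro E _ E' _
    exact hcls E E'
  · -- (iv) cells of distinct classes are distinct
    intro E _ E' _ i _ i' _ hCC
    have hL : Lab (cls E) (idx (cls E) ((i : ℝ) * (R / S2))) = Lab (cls E') (idx (cls E') ((i' : ℝ) * (R / S2))) :=
      (Prod.mk.inj hCC).1
    set x := voronoiChain σ₁ σ₂ (Ag (cls E)) (x₀ (cls E)) (idx (cls E) ((i : ℝ) * (R / S2))) with hx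
    set x' := voronoiChain σ₁ σ₂ (Ag (cls E')) (x₀ (cls E')) (idx (cls E') ((i' : ℝ) * (R / S2))) with hx'
    have hx0 : x ≠ 0 := (map_ne_zero σ₁).mp (hposc (cls E) _).ne'
    have hx'0 : x' ≠ 0 := (map_ne_zero σ₁).mp (hposc (cls E') _).ne'
    have hIJ : FractionalIdeal.spanSingleton (𝓞 K)⁰ x⁻¹ * Ag (cls E) =
        FractionalIdeal.spanSingleton (𝓞 K)⁰ x'⁻¹ * Ag (cls E') :=
      FractionalIdeal.ext fun φ => by rw [← ((hLab (cls E)) _).2 φ, ← ((hLab (cls E')) _).2 φ, hL]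
    exact hinj E E' x⁻¹ x'⁻¹ (inv_ne_zero hx0) (inv_ne_zero hx'0) hIJ
  · -- (v) the roundings
    intro E _
    have h := hyfloor E
    rw [abs_le]; constructor <;> linarith [h.1, h.2]
  · -- (v) exact affinity
    intro E _ E' _ hEE'
    exact hyaff E E' hEE'
  · -- (vi) run-shaped fibres, few cells
    intro E _
    exact cells_package (hmono (cls E)) (hn₀ (cls E)) (hper (cls E)) (hidx (cls E)) (hLabper (cls E)) s npp (hgap (cls E))
      hLB0 hLBd6 hRd6 (hn₀R (cls E)) hd1 hd27

/-- **The table semantics** `ClaimTableSem` (P5b of line `arakelov-giant-step-cycle`), from its four registered parts. -/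
theorem claimTableSem_holds : ClaimTableSem :=
  stub_semMain stub_semCoords stub_semDrift stub_semAffine

/-- **Crux `PureCubicClassGroupFBQP` (stmt-QuantumAdvantage-11544), proved**: `DegreeOnePrimesEscape →` the low `2|x|+8` bits of
`h(ℚ(∛m))`, `m = decodeNat x` a non-cube, are an `FBQP` function of `x` (line `arakelov-giant-step-cycle`, all stubs landed). -/
theorem PureCubicClassGroupFBQP_proof :
    Summit.QuantumAdvantage.QuantumAdvantage.Theses.LinnikCubicClassGroups.PureCubicClassGroupFBQP :=
  PureCubicClassGroupFBQP_of_parts claimTableSem_holds stub_classSamplingLaw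

end Summit.QuantumAdvantage.QuantumAdvantage.Theorems.LinnikCubicClassGroups
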